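import Mathlib
import Summits.CriticalPhenomena.CardyFormulaZ2.Theorems.CardySelfRefinementDefs
import Summits.CriticalPhenomena.CardyFormulaZ2.Theorems.CardySelfRefinementGradientComparabilityStubCornerHWBBypassMeasure
import Summits.CriticalPhenomena.CardyFormulaZ2.Theorems.CardySelfRefinementGradientComparabilityStubCornerHWBSegment
import Summits.CriticalPhenomena.CardyFormulaZ2.Theorems.CardySelfRefinementGradientComparabilityStubCornerHWBAssembly
import HarnessLib

/-!
# Crux `GradientComparability` (stmt-CriticalPhenomena-10269), line `monotone-product-coordinates` —
# stub `stub_cornerHardWayBoxes` (HWB), brick (ii-c): the Aizenman–Grimmett interior-bypass inequality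

Route `CardySelfRefinement`; vocabulary from `CardySelfRefinementDefs` (`ax cfg dirVec`); the per-bundle
cost of the bypass surgery from `…StubCornerHWBBypassMeasure`; Russo's formula by bundles for the
three-parameter family (`hasDerivWithinAt_real_shared`, `hasDerivWithinAt_real_interior`) from
`…StubCornerHWBRhoLeg` / `…StubCornerHWBSegment`; the finite coin supports of the box events from
`…StubCornerHWBAssembly`.

## Mathematics

For `k = 2, 3`, `0 < c₀ ≤ 1`, a hard-way box event `X` of the drawing `√2 ℤ² - w` at scale `n ≥ 3`
and `F(ρ, p, c) = M_k(ρ, c; p)(X)`: by Russo's formula `∂pF = Σ_b P(sh_b pivotal)` over bundles and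
`∂cF = Σ_{g interior} P(own_g pivotal)` (`infl_eq_real_pivotal`); the vertex box of `X` is box-closed
with the two-neighbour property (both windows have width `≥ 3 > 2√2`, `boxRegion_props`) and the two
targets are slabs, so `real_sharedPivotal_le_sum_interior` applies with `c₁ = c₀/2`
(`p ≤ 3/4`, interior bias `c ≥ c₀/2`); each interior edge lies in the strips of at most `32` bundles
and coins outside the support are never pivotal (`sum_strip_le`).  Hence
`∂pF ≤ 128 (4/c₀)^{2(k+3)²} ∂cF` on `[1/2, 1] × [1/2, 3/4] × [c₀/2, c₀]`, uniformly in `n ≥ 3` and `w`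
(`shared_le_mul_interior`, REGISTERED: brick (ii-c), the hypothesis of
`stub_cornerHardWayBoxes_of_sharedLeInterior`).  (Aizenman–Grimmett, J. Stat. Phys. 63 (1991);
Grimmett 1999 §3.3; Russo 1981.)
-/

noncomputable section

namespace Summit.CriticalPhenomena.CardyFormulaZ2.Theorems.CardySelfRefinement

open scoped Topology
open Filter Set MeasureTheory
open Literature.Probability.LatticeModels Literature.Probability.Percolation
open Literature.Probability.Percolation.QuadCrossing
open Summit.CriticalPhenomena.CardyFormulaZ2.Theses.CardySelfRefinement

/-- Box-closed vertex sets (local notation): with two points, `R` contains the lattice box they span. -/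
local notation3 (prettyPrint := false) "BoxClosed(" R ")" =>
  (∀ u ∈ (R : Set (Site 2)), ∀ w ∈ R, ∀ v : Site 2, (∀ j : Fin 2, min (u j) (w j) ≤ v j ∧ v j ≤ max (u j) (w j)) → v ∈ R)

/-- The strip box of the bundle `(t, d)` as a `Finset` of sites (local notation). -/
local notation3 (prettyPrint := false) "NF(" k ", " t ", " d ")" =>
  (Finset.Icc (fun j : Fin 2 => (k : ℤ) * t j - 1) (fun j : Fin 2 => (k : ℤ) * t j + (if j = d then (k : ℤ) + 1 else 1)) : Finset (Site 2))

/-- The interior edges of the strip of the bundle `(t, d)` (local notation): non-axial edges with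
both endpoints in the strip box. -/
local notation3 (prettyPrint := false) "ByE(" k ", " t ", " d ")" =>
  ((NF(k, t, d) ×ˢ (Finset.univ : Finset (Fin 2))).filter
    (fun g : Site 2 × Fin 2 => ¬ ax k g ∧ g.1 + dirVec g.2 ∈ NF(k, t, d)))

/-! ## Assembly of brick (ii-c) -/

/-- The three-parameter coin law of `M_k(ρ, c; p)` (local notation, as in `…StubCornerHWBRhoLeg`). -/
local notation3 (prettyPrint := false) "prm₃(" k ", " ρ ", " p ", " c ")" =>
  (fun i : Site 2 × Fin 2 × Fin 3 =>
    if i.2.2 = 0 then (if ax k (i.1, i.2.1) then half else Set.projIcc (0 : ℝ) 1 zero_le_one c)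
    else if i.2.2 = 1 then Set.projIcc (0 : ℝ) 1 zero_le_one p
    else Set.projIcc (0 : ℝ) 1 zero_le_one ρ : Site 2 × Fin 2 × Fin 3 → unitInterval)

/-- For a coin which is not a selector the influence on an increasing event is the probability that
the coin is pivotal. -/
theorem infl_eq_real_pivotal (k : ℕ) {X : Set (BondConfig (Site 2))} (hX : IsUpperSet X)
    (hXm : MeasurableSet X) (ν : Measure (Set (Site 2 × Fin 2 × Fin 3))) [IsFiniteMeasure ν]
    (i : Site 2 × Fin 2 × Fin 3) (hi : i.2.2 ≠ 2) :
    ν.real {S | insert i S ∈ (cfg k) ⁻¹' X} - ν.real {S | S \ {i} ∈ (cfg k) ⁻¹' X} =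
      ν.real {S | insert i S ∈ (cfg k) ⁻¹' X ∧ S \ {i} ∉ (cfg k) ⁻¹' X} := by
  have hsub : {S | S \ {i} ∈ (cfg k) ⁻¹' X} ⊆ {S | insert i S ∈ (cfg k) ⁻¹' X} := by
    intro S hS
    refine hX (cfg_mono_of_selectors k ?_ fun x hx hx2 => ?_) hS
    · exact Set.sdiff_subset.trans (Set.subset_insert _ _)
    · rcases hx with rfl | hx
      · exact absurd hx2 hi
      · exact ⟨hx, fun h => hi (by rw [Set.mem_singleton_iff.1 h] at hx2; exact hx2)⟩
  have e : {S | insert i S ∈ (cfg k) ⁻¹' X ∧ S \ {i} ∉ (cfg k) ⁻¹' X} =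
      {S | insert i S ∈ (cfg k) ⁻¹' X} \ {S | S \ {i} ∈ (cfg k) ⁻¹' X} := rfl
  rw [e, measureReal_sdiff hsub ((measurable_sdiff_pt i) (measurable_cfg k hXm))]

/-- A coin outside a determining set is never pivotal. -/
theorem pivotal_eq_empty_of_notMem {ι : Type*} {E : Set (Set ι)} {K : Set ι} (hE : DeterminedBy E K)
    {i : ι} (hi : i ∉ K) : {S : Set ι | insert i S ∈ E ∧ S \ {i} ∉ E} = ∅ := by
  ext S
  simp only [Set.mem_setOf_eq, Set.mem_empty_iff_false, iff_false, not_and, not_not]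
  intro h
  rw [determinedBy_iff] at hE
  refine (hE (insert i S) (S \ {i}) ?_).1 h
  rw [Set.insert_inter_of_notMem hi]
  ext x
  simp only [Set.mem_inter_iff, Set.mem_sdiff, Set.mem_singleton_iff]
  exact ⟨fun ⟨h1, h2⟩ => ⟨⟨h1, fun h => hi (h ▸ h2)⟩, h2⟩, fun ⟨⟨h1, _⟩, h2⟩ => ⟨h1, h2⟩⟩

/-- The bundles whose strip box contains a given site have their base in a `4 × 4` box. -/
theorem base_mem_Icc_of_mem_NF {k : ℕ} (hk : k = 2 ∨ k = 3) {t : Site 2} {d : Fin 2} {v : Site 2}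
    (hv : v ∈ NF(k, t, d)) :
    t ∈ Finset.Icc (fun j : Fin 2 => v j / (k : ℤ) - 2) (fun j : Fin 2 => v j / (k : ℤ) + 1) := by
  rw [Finset.mem_Icc, Pi.le_def, Pi.le_def] at hv ⊢
  refine ⟨fun j => ?_, fun j => ?_⟩
  · have h1 := hv.1 j
    have h2 := hv.2 j
    rcases hk with rfl | rfl <;> split_ifs at h2 <;> push_cast at * <;> omega
  · have h1 := hv.1 j
    have h2 := hv.2 j
    rcases hk with rfl | rfl <;> split_ifs at h2 <;> push_cast at * <;> omega

/-- A `4 × 4` box of bases times the two directions has `32` elements. -/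
theorem card_back_le (k : ℕ) (v : Site 2) :
    ((Finset.Icc (fun j : Fin 2 => v j / (k : ℤ) - 2) (fun j : Fin 2 => v j / (k : ℤ) + 1)) ×ˢ
      (Finset.univ : Finset (Fin 2))).card ≤ 32 := by
  rw [Finset.card_product, Finset.card_univ, Fintype.card_fin, Pi.card_Icc]
  have h : ∏ j, (Finset.Icc ((fun j : Fin 2 => v j / (k : ℤ) - 2) j)
      ((fun j : Fin 2 => v j / (k : ℤ) + 1) j)).card ≤ 4 ^ (Finset.univ : Finset (Fin 2)).card := by
    refine Finset.prod_le_pow_card _ _ _ fun j _ => ?_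
    rw [Int.card_Icc]
    refine Int.toNat_le.2 ?_
    push_cast
    linarith
  simp only [Finset.card_univ, Fintype.card_fin] at h
  linarith

/-- **Double counting.**  Summing, over the bundles `td ∈ T`, a nonnegative function over the
interior strip edges of `td` counts each edge at most `32` times; edges outside `T` carrying zero
weight, the total is at most `32 Σ_{g ∈ T, ¬ axial} F g`. -/
theorem sum_strip_le {k : ℕ} (hk : k = 2 ∨ k = 3) (T : Finset (Site 2 × Fin 2)) (F : Site 2 × Fin 2 → ℝ)
    (hF : ∀ g, 0 ≤ F g) (hF0 : ∀ g, g ∉ T → F g = 0) :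
    ∑ td ∈ T, ∑ g ∈ ByE(k, td.1, td.2), F g ≤ 32 * ∑ g ∈ T, (if ax k g then (0 : ℝ) else 1) * F g := by
  classical
  set G : Site 2 × Fin 2 → Finset (Site 2 × Fin 2) := fun td => ByE(k, td.1, td.2) with hG
  have hswap : ∑ td ∈ T, ∑ g ∈ G td, F g =
      ∑ g ∈ T.biUnion G, ∑ _td ∈ T.filter (fun td => g ∈ G td), F g := by
    refine Finset.sum_comm' fun td g => ?_
    simp only [Finset.mem_filter, Finset.mem_biUnion]
    exact ⟨fun ⟨h1, h2⟩ => ⟨⟨h1, h2⟩, td, h1, h2⟩, fun ⟨⟨h1, h2⟩, _⟩ => ⟨h1, h2⟩⟩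
  have hcount : ∀ g, (T.filter (fun td => g ∈ G td)).card ≤ 32 := by
    intro g
    refine le_trans (Finset.card_le_card fun td htd => ?_) (card_back_le k g.1)
    rw [Finset.mem_filter] at htd
    have hg := (Finset.mem_filter.1 htd.2).1
    rw [Finset.mem_product] at hg
    exact Finset.mem_product.2 ⟨base_mem_Icc_of_mem_NF hk hg.1, Finset.mem_univ _⟩
  have hzero : ∀ g ∈ T.biUnion G, g ∉ T.filter (fun g => ¬ ax k g) → F g = 0 := by
    intro g hg hgT
    refine hF0 g fun hgT' => hgT (Finset.mem_filter.2 ⟨hgT', ?_⟩)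
    obtain ⟨td, -, htd⟩ := Finset.mem_biUnion.1 hg
    exact (Finset.mem_filter.1 htd).2.1
  calc ∑ td ∈ T, ∑ g ∈ G td, F g
      = ∑ g ∈ T.biUnion G, ∑ _td ∈ T.filter (fun td => g ∈ G td), F g := hswap
    _ ≤ ∑ g ∈ T.biUnion G, 32 * F g := by
        refine Finset.sum_le_sum fun g _ => ?_
        rw [Finset.sum_const, nsmul_eq_mul]
        exact mul_le_mul_of_nonneg_right (by exact_mod_cast hcount g) (hF g)
    _ = 32 * ∑ g ∈ T.biUnion G, F g := by rw [Finset.mul_sum]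
    _ ≤ 32 * ∑ g ∈ T.filter (fun g => ¬ ax k g), F g := by
        refine mul_le_mul_of_nonneg_left ?_ (by norm_num)
        rw [← Finset.sum_filter_of_ne (p := fun g => g ∈ T.filter (fun g => ¬ ax k g))
          (fun g hg hne => by_contra fun h => hne (hzero g hg h))]
        exact Finset.sum_le_sum_of_subset_of_nonneg (fun g hg => (Finset.mem_filter.1 hg).2)
          (fun g _ _ => hF g)
    _ = 32 * ∑ g ∈ T, (if ax k g then (0 : ℝ) else 1) * F g := by
        rw [Finset.sum_filter]
        congr 1
        refine Finset.sum_congr rfl fun g _ => ?_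
        split_ifs <;> simp

/-- **Brick (ii-c) for an open crossing event of a box-closed two-neighbour region between slabs.**
`∂p F ≤ 128 (4/c₀)^{2(k+3)²} ∂c F` on `[1/2, 1] × [1/2, 3/4] × [c₀/2, c₀]`. -/
theorem derivWithin_shared_le_interior_openCrossing {k : ℕ} (hk : k = 2 ∨ k = 3)
    {R A B : Set (Site 2)} (j₁ : Fin 2) (hRc : BoxClosed(R))
    (hR2 : ∀ v ∈ R, ∀ j : Fin 2, v + dirVec j ∈ R ∨ v - dirVec j ∈ R)
    (hA : ∀ v ∈ A, v + dirVec j₁ ∈ A ∧ v - dirVec j₁ ∈ A)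
    (hB : ∀ v ∈ B, v + dirVec j₁ ∈ B ∧ v - dirVec j₁ ∈ B)
    (hXm : MeasurableSet (openCrossing R A B)) (K : Finset (Site 2 × Fin 2 × Fin 3))
    (hK : DeterminedBy ((cfg k) ⁻¹' openCrossing R A B) (↑K : Set (Site 2 × Fin 2 × Fin 3)))
    {c₀ : ℝ} (hc₀ : 0 < c₀) (hc₁ : c₀ ≤ 1) (ρ : ℝ) {p : ℝ}
    (hp : p ∈ Set.Icc (1 / 2 : ℝ) (3 / 4)) {c : ℝ} (hc : c ∈ Set.Icc (c₀ / 2) c₀) :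
    derivWithin (fun p' => ((prodBernoulli prm₃(k, ρ, p', c)).map (cfg k)).real (openCrossing R A B))
        (Set.Icc 0 1) p ≤
      (128 * (4 / c₀) ^ (2 * (k + 3) ^ 2)) *
        derivWithin (fun c' => ((prodBernoulli prm₃(k, ρ, p, c')).map (cfg k)).real (openCrossing R A B))
          (Set.Icc 0 1) c := by
  classical
  set X := openCrossing R A B with hXdef
  have hX : IsUpperSet X := isUpperSet_openCrossing R A B
  set T : Finset (Site 2 × Fin 2) := K.image fun i => (i.1, i.2.1) with hT
  have hE : DeterminedBy ((cfg k) ⁻¹' X) ↑((T ×ˢ (Finset.univ : Finset (Fin 3))).map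
      (Equiv.prodAssoc (Site 2) (Fin 2) (Fin 3)).toEmbedding) := by
    refine hK.mono fun i hi => Finset.mem_coe.2 (Finset.mem_map.2 ⟨((i.1, i.2.1), i.2.2),
      Finset.mem_product.2 ⟨Finset.mem_image_of_mem _ (Finset.mem_coe.1 hi), Finset.mem_univ _⟩,
      rfl⟩)
  have hF : ∀ p₁ c₁ : ℝ, ((prodBernoulli prm₃(k, ρ, p₁, c₁)).map (cfg k)).real X =
      (prodBernoulli prm₃(k, ρ, p₁, c₁)).real ((cfg k) ⁻¹' X) := fun _ _ =>
    map_measureReal_apply (measurable_cfg k) hXm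
  have hp' : p ∈ Set.Icc (0 : ℝ) 1 := ⟨by linarith [hp.1], by linarith [hp.2]⟩
  have hc' : c ∈ Set.Icc (0 : ℝ) 1 := ⟨by linarith [hc.1], by linarith [hc.2]⟩
  simp only [hF]
  rw [(hasDerivWithinAt_real_shared k ρ c hp' T hE).derivWithin (uniqueDiffOn_Icc zero_lt_one p hp'),
    (hasDerivWithinAt_real_interior k ρ p hc' T hE).derivWithin (uniqueDiffOn_Icc zero_lt_one c hc')]
  set μ := prodBernoulli prm₃(k, ρ, p, c) with hμ
  set E := (cfg k) ⁻¹' X with hEdef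
  set f : Site 2 × Fin 2 × Fin 3 → ℝ := fun i => μ.real {S | insert i S ∈ E ∧ S \ {i} ∉ E} with hf
  have hinfl : ∀ i : Site 2 × Fin 2 × Fin 3, i.2.2 ≠ 2 →
      μ.real {S | insert i S ∈ E} - μ.real {S | S \ {i} ∈ E} = f i := fun i hi =>
    infl_eq_real_pivotal k hX hXm μ i hi
  have hf0 : ∀ i, 0 ≤ f i := fun i => measureReal_nonneg
  -- the constants
  set c₁ := c₀ / 2 with hc₁def
  have hc₁0 : 0 < c₁ := by positivity
  have hc₁1 : c₁ ≤ 1 := by linarith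
  set M : ℕ := 2 * (k + 3) ^ 2 with hM
  have hq0 : ∀ g : Site 2 × Fin 2, ¬ ax k g → c₁ ≤ ((prm₃(k, ρ, p, c)) (g.1, g.2, (0 : Fin 3)) : ℝ) := by
    intro g hg
    have : ((prm₃(k, ρ, p, c)) (g.1, g.2, (0 : Fin 3)) : ℝ) = c := by
      simp [hg, Set.projIcc_of_mem _ hc']
    rw [this]
    exact hc.1
  have hq1 : ∀ td : Site 2 × Fin 2, ((prm₃(k, ρ, p, c)) (td.1, td.2, (1 : Fin 3)) : ℝ) ≤ 3 / 4 := by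
    intro td
    simp [Set.projIcc_of_mem _ hp', hp.2]
  -- per bundle
  have hbundle : ∀ td ∈ T, f (td.1, td.2, (1 : Fin 3)) ≤
      4 * (2 / c₁) ^ M * ∑ g ∈ ByE(k, td.1, td.2), f (g.1, g.2, (0 : Fin 3)) := fun td _ =>
    real_sharedPivotal_le_sum_interior k hk td.1 td.2 R A B j₁ hRc hR2 hA hB hXm _ c₁ hc₁0 hc₁1 hq0 (hq1 td)
  -- vanishing outside `T`
  have hvan : ∀ g : Site 2 × Fin 2, g ∉ T → f (g.1, g.2, (0 : Fin 3)) = 0 := by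
    intro g hg
    have hi : (g.1, g.2, (0 : Fin 3)) ∉ (↑((T ×ˢ (Finset.univ : Finset (Fin 3))).map
        (Equiv.prodAssoc (Site 2) (Fin 2) (Fin 3)).toEmbedding) : Set (Site 2 × Fin 2 × Fin 3)) := by
      intro h
      obtain ⟨x, hx, hxe⟩ := Finset.mem_map.1 (Finset.mem_coe.1 h)
      have : x.1 = g := by
        have h1 := congrArg Prod.fst hxe
        have h2 := congrArg (fun y => y.2.1) hxe
        simp only [Equiv.toEmbedding_apply, Equiv.prodAssoc_apply] at h1 h2
        exact Prod.ext h1 h2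
      exact hg (this ▸ (Finset.mem_product.1 hx).1)
    simp only [hf]
    rw [pivotal_eq_empty_of_notMem hE hi, measureReal_empty]
  have hC : 0 ≤ 4 * (2 / c₁) ^ M := by positivity
  have hL : 4 * (2 / c₁) ^ M * 32 = 128 * (4 / c₀) ^ (2 * (k + 3) ^ 2) := by
    rw [hM, hc₁def, div_div_eq_mul_div]
    norm_num
    ring
  calc ∑ td ∈ T, (μ.real {S | insert (td.1, td.2, (1 : Fin 3)) S ∈ E} -
        μ.real {S | S \ {(td.1, td.2, (1 : Fin 3))} ∈ E})
      = ∑ td ∈ T, f (td.1, td.2, (1 : Fin 3)) := Finset.sum_congr rfl fun td _ => hinfl _ (by simp)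
    _ ≤ ∑ td ∈ T, 4 * (2 / c₁) ^ M * ∑ g ∈ ByE(k, td.1, td.2), f (g.1, g.2, (0 : Fin 3)) :=
        Finset.sum_le_sum hbundle
    _ = 4 * (2 / c₁) ^ M * ∑ td ∈ T, ∑ g ∈ ByE(k, td.1, td.2), f (g.1, g.2, (0 : Fin 3)) := by
        rw [Finset.mul_sum]
    _ ≤ 4 * (2 / c₁) ^ M * (32 * ∑ g ∈ T, (if ax k g then (0 : ℝ) else 1) * f (g.1, g.2, (0 : Fin 3))) :=
        mul_le_mul_of_nonneg_left (sum_strip_le hk T (fun g => f (g.1, g.2, (0 : Fin 3)))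
          (fun g => hf0 _) hvan) hC
    _ = (128 * (4 / c₀) ^ (2 * (k + 3) ^ 2)) *
          ∑ td ∈ T, (if ax k td then (0 : ℝ) else 1) *
            (μ.real {S | insert (td.1, td.2, (0 : Fin 3)) S ∈ E} -
              μ.real {S | S \ {(td.1, td.2, (0 : Fin 3))} ∈ E}) := by
        rw [← mul_assoc, hL]
        congr 1
        exact Finset.sum_congr rfl fun td _ => by rw [hinfl _ (by simp)]


/-! ## The two hard-way box events of the drawing `√2 ℤ² - w` -/

/-- Betweenness along one coordinate of the drawing `√2 ℤ² - w`. -/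
theorem sqrt2_between {a b r : ℝ} {u w v : ℤ} (hu : Real.sqrt 2 * (u : ℝ) - r ∈ Set.Icc a b)
    (hw : Real.sqrt 2 * (w : ℝ) - r ∈ Set.Icc a b) (h : min u w ≤ v ∧ v ≤ max u w) :
    Real.sqrt 2 * (v : ℝ) - r ∈ Set.Icc a b := by
  have hs : (0 : ℝ) ≤ Real.sqrt 2 := Real.sqrt_nonneg 2
  rcases le_total u w with huw | huw
  · rw [min_eq_left huw, max_eq_right huw] at h
    have h1 : (u : ℝ) ≤ v := by exact_mod_cast h.1
    have h2 : (v : ℝ) ≤ w := by exact_mod_cast h.2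
    constructor <;> nlinarith [hu.1, hw.2, mul_le_mul_of_nonneg_left h1 hs,
      mul_le_mul_of_nonneg_left h2 hs]
  · rw [min_eq_right huw, max_eq_left huw] at h
    have h1 : (w : ℝ) ≤ v := by exact_mod_cast h.1
    have h2 : (v : ℝ) ≤ u := by exact_mod_cast h.2
    constructor <;> nlinarith [hw.1, hu.2, mul_le_mul_of_nonneg_left h1 hs,
      mul_le_mul_of_nonneg_left h2 hs]

/-- A unit step along one coordinate stays in a window of width `≥ 3 > 2√2`, on one side. -/
theorem sqrt2_step {a b r : ℝ} {x : ℤ} (hab : 3 ≤ b - a) (hx : Real.sqrt 2 * (x : ℝ) - r ∈ Set.Icc a b) :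
    Real.sqrt 2 * ((x : ℝ) + 1) - r ∈ Set.Icc a b ∨ Real.sqrt 2 * ((x : ℝ) - 1) - r ∈ Set.Icc a b := by
  have hs2 : Real.sqrt 2 < 3 / 2 := (Real.sqrt_lt' (by norm_num)).2 (by norm_num)
  have hs : (0 : ℝ) ≤ Real.sqrt 2 := Real.sqrt_nonneg 2
  by_cases h : Real.sqrt 2 * (x : ℝ) - r + Real.sqrt 2 ≤ b
  · left
    constructor <;> nlinarith [hx.1, hx.2]
  · right
    constructor <;> nlinarith [hx.1, hx.2]

/-- **The vertex box of a box event is box-closed and has the two-neighbour property** (both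
windows of width `≥ 3`). -/
theorem boxRegion_props (w : ℂ) {a₁ b₁ a₂ b₂ : ℝ} (h₁ : 3 ≤ b₁ - a₁) (h₂ : 3 ≤ b₂ - a₂) :
    BoxClosed({v : Site 2 | (squareLatticeEmbedding.z v - w).re ∈ Set.Icc a₁ b₁ ∧
      (squareLatticeEmbedding.z v - w).im ∈ Set.Icc a₂ b₂}) ∧
    ∀ v ∈ {v : Site 2 | (squareLatticeEmbedding.z v - w).re ∈ Set.Icc a₁ b₁ ∧
      (squareLatticeEmbedding.z v - w).im ∈ Set.Icc a₂ b₂}, ∀ j : Fin 2,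
      v + dirVec j ∈ {v : Site 2 | (squareLatticeEmbedding.z v - w).re ∈ Set.Icc a₁ b₁ ∧
        (squareLatticeEmbedding.z v - w).im ∈ Set.Icc a₂ b₂} ∨
      v - dirVec j ∈ {v : Site 2 | (squareLatticeEmbedding.z v - w).re ∈ Set.Icc a₁ b₁ ∧
        (squareLatticeEmbedding.z v - w).im ∈ Set.Icc a₂ b₂} := by
  simp only [Set.mem_setOf_eq, squareLatticeEmbedding_z_sub_re, squareLatticeEmbedding_z_sub_im]
  refine ⟨fun u hu w' hw' v hv => ⟨sqrt2_between hu.1 hw'.1 (hv 0), sqrt2_between hu.2 hw'.2 (hv 1)⟩,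
    fun v hv j => ?_⟩
  rcases fin_two_cases_of_ne (show (1 : Fin 2) ≠ 0 by decide) j with rfl | rfl
  · rw [show (v + dirVec 0) 0 = v 0 + 1 by rw [add_dirVec_apply, if_pos rfl],
      show (v + dirVec 0) 1 = v 1 by rw [add_dirVec_apply, if_neg (by decide), add_zero],
      show (v - dirVec 0) 0 = v 0 - 1 by rw [sub_dirVec_apply, if_pos rfl],
      show (v - dirVec 0) 1 = v 1 by rw [sub_dirVec_apply, if_neg (by decide), sub_zero]]
    push_cast
    rcases sqrt2_step h₁ hv.1 with h | h
    · exact Or.inl ⟨h, hv.2⟩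
    · exact Or.inr ⟨h, hv.2⟩
  · rw [show (v + dirVec 1) 1 = v 1 + 1 by rw [add_dirVec_apply, if_pos rfl],
      show (v + dirVec 1) 0 = v 0 by rw [add_dirVec_apply, if_neg (by decide), add_zero],
      show (v - dirVec 1) 1 = v 1 - 1 by rw [sub_dirVec_apply, if_pos rfl],
      show (v - dirVec 1) 0 = v 0 by rw [sub_dirVec_apply, if_neg (by decide), sub_zero]]
    push_cast
    rcases sqrt2_step h₂ hv.2 with h | h
    · exact Or.inl ⟨hv.1, h⟩
    · exact Or.inr ⟨hv.1, h⟩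

/-- Slabs in the real part are invariant under vertical unit steps. -/
theorem slab_re (w : ℂ) (P : ℝ → Prop) (v : Site 2) :
    (P (squareLatticeEmbedding.z (v + dirVec 1) - w).re ↔ P (squareLatticeEmbedding.z v - w).re) ∧
      (P (squareLatticeEmbedding.z (v - dirVec 1) - w).re ↔ P (squareLatticeEmbedding.z v - w).re) := by
  simp only [squareLatticeEmbedding_z_sub_re, add_dirVec_apply, sub_dirVec_apply]
  simp

/-- Slabs in the imaginary part are invariant under horizontal unit steps. -/
theorem slab_im (w : ℂ) (P : ℝ → Prop) (v : Site 2) :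
    (P (squareLatticeEmbedding.z (v + dirVec 0) - w).im ↔ P (squareLatticeEmbedding.z v - w).im) ∧
      (P (squareLatticeEmbedding.z (v - dirVec 0) - w).im ↔ P (squareLatticeEmbedding.z v - w).im) := by
  simp only [squareLatticeEmbedding_z_sub_im, add_dirVec_apply, sub_dirVec_apply]
  simp

/-- **Brick (ii-c) of stub `stub_cornerHardWayBoxes` (HWB): the Aizenman–Grimmett interior-bypass
inequality for the hard-way boxes.**  For `k = 2, 3` and `0 < c₀ ≤ 1` there are `L ≥ 1`
(`L = 128 (4/c₀)^{2(k+3)²}`) and `n₁` (`= 3`) such that for all scales `n ≥ n₁`, all translates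
`w`, and both hard-way box events `X` (aspect ratio `8`) of the drawing `√2 ℤ² - w`, the
three-parameter crossing probability `F(ρ, p, c) = M_k(ρ, c; p)(X)` (own coins fair on axial edges
and `c` on interior edges, shared coins `p`, selectors `ρ`, pushed forward by `cfg k`) satisfies
`∂p F ≤ L ∂c F` (one-sided derivatives within `[0,1]`) for `ρ ∈ [1/2, 1]`, `p ∈ [1/2, 3/4]`,
`c ∈ [c₀/2, c₀]`.  By Russo's formula both sides are influence sums; a pivotal shared coin of a
bundle is turned into a pivotal interior coin of its strip by the bypass surgery
(`bypass_openCrossing`) at cost `≤ 4 (4/c₀)^{2(k+3)²}` (`real_sharedPivotal_le_sum_interior`), and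
each interior edge lies in at most `32` strips. -/
theorem shared_le_mul_interior : ∀ k : ℕ, k = 2 ∨ k = 3 → ∀ c₀ : ℝ, 0 < c₀ → c₀ ≤ 1 → ∃ L : ℝ, 1 ≤ L ∧ ∃ n₁ : ℕ, ∀ n : ℕ, n₁ ≤ n → ∀ w : ℂ, (∀ ρ ∈ Set.Icc (1 / 2 : ℝ) 1, ∀ p ∈ Set.Icc (1 / 2 : ℝ) (3 / 4), ∀ c ∈ Set.Icc (c₀ / 2) c₀, derivWithin (fun p' => ((prodBernoulli (fun i : Site 2 × Fin 2 × Fin 3 => if i.2.2 = 0 then (if ax k (i.1, i.2.1) then half else Set.projIcc (0 : ℝ) 1 zero_le_one c) else if i.2.2 = 1 then Set.projIcc (0 : ℝ) 1 zero_le_one p' else Set.projIcc (0 : ℝ) 1 zero_le_one ρ)).map (cfg k)).real (embRectCrossing (fun v => squareLatticeEmbedding.z v - w) (8 * n) n)) (Set.Icc 0 1) p ≤ L * derivWithin (fun c' => ((prodBernoulli (fun i : Site 2 × Fin 2 × Fin 3 => if i.2.2 = 0 then (if ax k (i.1, i.2.1) then half else Set.projIcc (0 : ℝ) 1 zero_le_one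 c') else if i.2.2 = 1 then Set.projIcc (0 : ℝ) 1 zero_le_one p else Set.projIcc (0 : ℝ) 1 zero_le_one ρ)).map (cfg k)).real (embRectCrossing (fun v => squareLatticeEmbedding.z v - w) (8 * n) n)) (Set.Icc 0 1) c) ∧ (∀ ρ ∈ Set.Icc (1 / 2 : ℝ) 1, ∀ p ∈ Set.Icc (1 / 2 : ℝ) (3 / 4), ∀ c ∈ Set.Icc (c₀ / 2) c₀, derivWithin (fun p' => ((prodBernoulli (fun i : Site 2 × Fin 2 × Fin 3 => if i.2.2 = 0 then (if ax k (i.1, i.2.1) then half else Set.projIcc (0 : ℝ) 1 zero_le_one c) else if i.2.2 = 1 then Set.projIcc (0 : ℝ) 1 zero_le_one p' else Set.projIcc (0 : ℝ) 1 zero_le_one ρ)).map (cfg k)).real (embTBCrossing (fun v => squareLatticeEmbedding.z v - w) n (8 * n))) (Set.Icc 0 1) p ≤ L * derivWithin (fun c' => ((prodBernoulli (fun i : Site 2 × Fin 2 × Fin 3 => if i.2.2 = 0 then (if ax k (i.1, i.2.1) then half else Set.projIcc (0 : ℝ) 1 zero_le_one c') else if i.2.2 = 1 then Set.projIcc (0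 : ℝ) 1 zero_le_one p else Set.projIcc (0 : ℝ) 1 zero_le_one ρ)).map (cfg k)).real (embTBCrossing (fun v => squareLatticeEmbedding.z v - w) n (8 * n))) (Set.Icc 0 1) c) := by
  intro k hk c₀ hc₀ hc₀1
  refine ⟨128 * (4 / c₀) ^ (2 * (k + 3) ^ 2), ?_, 3, fun n hn w => ⟨?_, ?_⟩⟩
  · have h4 : (1 : ℝ) ≤ 4 / c₀ := by
      rw [le_div_iff₀ hc₀]
      linarith
    nlinarith [one_le_pow₀ (M₀ := ℝ) h4 (n := 2 * (k + 3) ^ 2)]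
  · intro ρ _ p hp c hc
    have hn3 : (3 : ℝ) ≤ n := by exact_mod_cast hn
    obtain ⟨hRc, hR2⟩ := boxRegion_props w (a₁ := -2) (b₁ := 8 * n + 2) (a₂ := 0) (b₂ := n)
      (by linarith) (by linarith)
    obtain ⟨K, hK⟩ := exists_determinedBy_cfg_preimage_embRectCrossing k w (8 * n) n
    exact derivWithin_shared_le_interior_openCrossing hk 1 hRc hR2
      (fun v hv => ⟨(slab_re w (· ≤ 0) v).1.2 hv, (slab_re w (· ≤ 0) v).2.2 hv⟩)
      (fun v hv => ⟨(slab_re w ((8 * n : ℝ) ≤ ·) v).1.2 hv, (slab_re w ((8 * n : ℝ) ≤ ·) v).2.2 hv⟩)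
      (IsoradialArmExtension.measurableSet_embRectCrossing _ _ _) K hK hc₀ hc₀1 ρ hp hc
  · intro ρ _ p hp c hc
    have hn3 : (3 : ℝ) ≤ n := by exact_mod_cast hn
    obtain ⟨hRc, hR2⟩ := boxRegion_props w (a₁ := 0) (b₁ := n) (a₂ := -2) (b₂ := 8 * n + 2)
      (by linarith) (by linarith)
    obtain ⟨K, hK⟩ := exists_determinedBy_cfg_preimage_embTBCrossing k w n (8 * n)
    exact derivWithin_shared_le_interior_openCrossing hk 0 hRc hR2
      (fun v hv => ⟨(slab_im w (· ≤ 0) v).1.2 hv, (slab_im w (· ≤ 0) v).2.2 hv⟩)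
      (fun v hv => ⟨(slab_im w ((8 * n : ℝ) ≤ ·) v).1.2 hv, (slab_im w ((8 * n : ℝ) ≤ ·) v).2.2 hv⟩)
      (IsoradialArmExtension.measurableSet_embTBCrossing _ _ _) K hK hc₀ hc₀1 ρ hp hc

end Summit.CriticalPhenomena.CardyFormulaZ2.Theorems.CardySelfRefinement

end
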